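import Literature.NumberTheory.Rogawski1990.FinExplicitTransferFactorDeepValueInert     -- ★ `finHeckeValue_one'`; brings ★ `finHeckeValue_mul` (`FinExplicitTransferFactorCentral`), `finTau`, `finHeckeValue`
import Literature.NumberTheory.Rogawski1990.FinExplicitTransferFactorEventuallyConst   -- ★ `finHeckeValue_eventually_eq`, `finTau_eventually_eq` (`μ_v`, `τ_v` locally constant)
import Literature.NumberTheory.Automorphic.LocalRingUnitsCharacterLocallyConstant      -- ★ `exists_forall_box_apply_eq_one` (a continuous character of `(Π E_w)^×` is trivial on a box)
import HarnessLib

/-!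
# F0 · P3c · line LH6 «StCharTS» — road (D) «DEEP-FL», brick (c₅)(i) «MU-TRIV»: `μ_v` is trivial near `1` (and on a principal congruence box), hence `μ_v` and the
# factor `τ_v(γ_H) = μ_v(u)·μ_v(−χ_g(u)∕det g)⁻¹` are constant along cosets of that box

Cell `pub/hodgecm-mathlib`, crux H413 = `stmt-HodgeConjecture-24833` (lane `--supports … --as helper`), route HCCMUnconditional; seat LH10-p02 (g2) (free hand on line LH6's
road (D); desk F0P3b-plan (g23) DEAL «MU-TRIV★» 2026-09-02T05:44:41Z; road owner LH6-p04 (g2), consumer (c₅) «the scalar identity» of ROAD-D status v4 6a6e64fd5094df6c: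
`c_b · Ψ_H(t_H) = finTau(t_H)·finWeylRatio(t_H)·Ψ_G(ι t_H)` is CONSTANT on the support because (i) `μ_v` is trivial on the level-`n` units once `n ≥ cond μ_v`).
THEOREMS ONLY, sorry-free, ★-only imports; no definition ∕ instance ∕ notation ∕ named fact.  HONEST LABEL: HC_CM is proved only modulo the 7 printed citations (2 remaining:
hLiu418 = stmt-HodgeConjecture-24832, h413 = stmt-HodgeConjecture-24833) until rung 0 closes; count-neutral in-house structure (everything here is a few lines over ★
`exists_forall_box_apply_eq_one`, ★ `finHeckeValue_eventually_eq`, ★ `finTau_eventually_eq`, ★ `finHeckeValue_mul` — stated in the `hlevi` currency `finHeckeValue` ∕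
`finGammaTwo` ∕ `finTauArg` ∕ `finTau` of ★ `FinExplicitTransferFactor`).

THE MATHEMATICS ([Rogawski1990, §4.9 p. 55; Prop. 8.1.3 proof p. 116]; [TateThesis1967, §2.3]).  `μ_v = finHeckeValue μ` agrees on units with the continuous character
`μ.semilocalComponent v` of `(E_v)^×`, `E_v = Π_{w∣v} L_w`; a continuous `ℂˣ`-character of `(E_v)^×` is trivial on a principal congruence box `{u : |u_w − 1|_w < q_w^{−(n+1)} ∀ w}`
(★ `exists_forall_box_apply_eq_one`: `ℂˣ` has no small subgroups) — «`n ≥ cond(μ_v)`».  Hence (§1) `μ_v = 1` on that box and near `1`; (§2) `μ_v(x·y) = μ_v(x)` for `y` in the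
box (★ `finHeckeValue_mul`), so `τ_v(γ_H) = μ_v(u)·μ_v(y)⁻¹` (`u = γ₂ = finGammaTwo`, `y = −χ_g(u)∕det g = finTauArg`) takes the SAME value at `γ_H` and `γ_H⁰` whenever
`u(γ_H) ∈ u(γ_H⁰)·box` and `y(γ_H) ∈ y(γ_H⁰)·box` — the form the deep shell `b_H·(T_H ∩ K_H)` supplies (all coordinates move in level-`n` cosets); (§3) the
neighbourhood forms (★ `finTau_eventually_eq` read as `∃ U ∈ 𝓝 γ_H⁰`).
* §1 `isUnit_of_forall_valued_sub_one_lt`, **`exists_level_forall_finHeckeValue_eq_one`** (box ∕ conductor form), **`exists_nhds_one_forall_finHeckeValue_eq_one`**.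
* §2 `finHeckeValue_mul_eq_of_eq_one` (`μ_v(x·y) = μ_v(x)`, `μ_v(y) = 1`, ANY `x`), **`finTau_eq_of_mul_of_finHeckeValue_eq_one`** (coset constancy of `τ_v`),
  **`exists_level_forall_finTau_eq_of_mul`** (the level-`n` form).
* §3 `exists_nhds_forall_finTau_eq` (`∃ U ∈ 𝓝 γ_H⁰, ∀ γ_H ∈ U, τ_v(γ_H) = τ_v(γ_H⁰)` for `χ_g(u)` a unit at `γ_H⁰`).
* §4 (ED. 2) `finCharpolyTwo_eval_eq_of_glDiagonal_eq`, **`finTauArg_eq_of_glDiagonal_eq`** — the arguments READ AT THE DIAGONAL LEVI FRAME of `hlevi`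
  (`glDiagonal 2 d' = γ_H.1`): `χ_g(u) = (u − d'₀)(u − d'₁)`, `−χ_g(u)∕det g = −(u − d'₀)(u − d'₁)·d'₀⁻¹d'₁⁻¹` (Mathlib `Matrix.charpoly_diagonal`, `Matrix.det_diagonal`).

## References
* [Rogawski1990] J. D. Rogawski, *Automorphic Representations of Unitary Groups in Three Variables* (1990): §4.9 p. 55 (`τ_v`); Prop. 8.1.3 proof p. 116 («for `t` close to `1`»).
* [TateThesis1967] J. Tate, *Fourier analysis in number fields and Hecke's zeta-functions* (Thesis 1950; Cassels–Fröhlich 1967), §2.3 (quasi-characters trivial on `1 + 𝔭ⁿ`).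
-/

set_option autoImplicit false
-- the mandated namespace has the single-problem summit's repeated segment (`HodgeConjecture.HodgeConjecture`)
set_option linter.dupNamespace false

noncomputable section

open NumberField IsDedekindDomain Filter Topology
open Literature.NumberTheory Literature.NumberTheory.Automorphic Literature.NumberTheory.Automorphic.UnitaryGroup
open Literature.NumberTheory.GaloisRepresentations
open Literature.NumberTheory.Rogawski1990

namespace Summit.HodgeConjecture.HodgeConjecture.Cruxes.H413.F0P3cStCharTSMuTrivial

variable (L : Type) [Field L] [NumberField L] [IsCMField L] (v : HeightOneSpectrum (𝓞 ↥(maximalRealSubfield L)))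

/-! ## §1 `μ_v` is trivial on a principal congruence box and near `1` -/

omit [IsCMField L] in
/-- An element of `E_v = Π_{w∣v} L_w` within distance `< q_w^{−(n+1)} ≤ 1` of `1` at every `w` is a unit (each coordinate is non-zero in the field `L_w`).
[cite: TateThesis1967, §2.3] -/
theorem isUnit_of_forall_valued_sub_one_lt {x : UnitaryGroup.LocalRing L v} {n : ℕ}
    (hx : ∀ w : PlacesOver L v, Valued.v (x w - 1) < WithZero.exp (-((n + 1 : ℕ) : ℤ))) : IsUnit x := by
  refine Pi.isUnit_iff.2 fun w => isUnit_iff_ne_zero.2 fun h0 => ?_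
  have h := hx w
  rw [h0, zero_sub, Valuation.map_neg, Valuation.map_one, ← WithZero.exp_zero, WithZero.exp_lt_exp] at h
  omega

omit [IsCMField L] in
/-- **`μ_v = 1` ON A PRINCIPAL CONGRUENCE BOX («`n ≥ cond μ_v`»)**: there is `n` with `finHeckeValue μ x = 1` whenever `|x_w − 1|_w < q_w^{−(n+1)}` for all `w ∣ v`
(★ `exists_forall_box_apply_eq_one` for the continuous character ★ `μ.semilocalComponent v`; box elements are units).
[cite: TateThesis1967, §2.3] [cite: Rogawski1990, §4.9 p. 55] -/
theorem exists_level_forall_finHeckeValue_eq_one (μ : HeckeCharacter L) :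
    ∃ n : ℕ, ∀ x : UnitaryGroup.LocalRing L v,
      (∀ w : PlacesOver L v, Valued.v (x w - 1) < WithZero.exp (-((n + 1 : ℕ) : ℤ))) → finHeckeValue L v μ x = 1 := by
  obtain ⟨n, hn⟩ := UnitaryGroup.exists_forall_box_apply_eq_one L v (μ.semilocalComponent L v) (UnitaryGroup.continuous_semilocalComponent L μ)
  refine ⟨n, fun x hx => ?_⟩
  have hu : IsUnit x := isUnit_of_forall_valued_sub_one_lt L v hx
  rw [finHeckeValue_of_isUnit L v μ hu, hn hu.unit (fun w => by rw [IsUnit.unit_spec]; exact hx w), Units.val_one]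

omit [IsCMField L] in
/-- **`μ_v = 1` NEAR `1`**: `∃ U ∈ 𝓝 1, ∀ x ∈ U, finHeckeValue μ x = 1` (★ `finHeckeValue_eventually_eq` at the unit `1`, ★ `finHeckeValue_one'`).
[cite: Rogawski1990, §4.9 p. 55; Prop. 8.1.3 proof p. 116] [cite: TateThesis1967, §2.3] -/
theorem exists_nhds_one_forall_finHeckeValue_eq_one (μ : HeckeCharacter L) :
    ∃ U ∈ 𝓝 (1 : UnitaryGroup.LocalRing L v), ∀ x ∈ U, finHeckeValue L v μ x = 1 := by
  have h := finHeckeValue_eventually_eq L v μ (x := (1 : UnitaryGroup.LocalRing L v)) isUnit_one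
  rw [finHeckeValue_one'] at h
  exact h.exists_mem

/-! ## §2 Coset constancy of `μ_v` and of `τ_v` -/

omit [IsCMField L] in
/-- **`μ_v(x·y) = μ_v(x)` when `μ_v(y) = 1`, `y` a unit** — for EVERY `x` (a non-unit `x` gives `0 = 0`; ★ `finHeckeValue_mul` on units). [cite: Rogawski1990, §4.9 p. 55] -/
theorem finHeckeValue_mul_eq_of_eq_one (μ : HeckeCharacter L) {x y : UnitaryGroup.LocalRing L v} (hy : IsUnit y) (hy1 : finHeckeValue L v μ y = 1) :
    finHeckeValue L v μ (x * y) = finHeckeValue L v μ x := by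
  by_cases hx : IsUnit x
  · rw [finHeckeValue_mul L v μ hx hy, hy1, mul_one]
  · have hxy : ¬ IsUnit (x * y) := fun h => hx (isUnit_of_mul_isUnit_left h)
    rw [finHeckeValue_of_not_isUnit L v μ hx, finHeckeValue_of_not_isUnit L v μ hxy]

/-- **COSET CONSTANCY OF `τ_v`**: if the two arguments of `τ_v(γ_H) = μ_v(u)·μ_v(−χ_g(u)∕det g)⁻¹` (★ `finGammaTwo`, ★ `finTauArg`) at `γ_H` are those at `γ_H⁰` times units
`y₁, y₂` with `μ_v(y₁) = μ_v(y₂) = 1`, then `τ_v(γ_H) = τ_v(γ_H⁰)` (no regularity or unit hypothesis on `γ_H⁰` needed). [cite: Rogawski1990, §4.9 p. 55; Prop. 8.1.3 proof p. 116] -/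
theorem finTau_eq_of_mul_of_finHeckeValue_eq_one (μ : HeckeCharacter L)
    {γH γH₀ : (UnitaryGroup.cmDatum L 2 (Matrix.of fun i j : Fin 2 => if i.val + j.val + 1 = 2 then (1 : L) else 0)).Local v ×
      (UnitaryGroup.cmDatum L 1 (Matrix.of fun i j : Fin 1 => if i.val + j.val + 1 = 1 then (1 : L) else 0)).Local v}
    {y₁ y₂ : UnitaryGroup.LocalRing L v}
    (h₁ : finGammaTwo L v γH = finGammaTwo L v γH₀ * y₁) (h₂ : finTauArg L v γH = finTauArg L v γH₀ * y₂)
    (hy₁ : IsUnit y₁) (hy₁1 : finHeckeValue L v μ y₁ = 1) (hy₂ : IsUnit y₂) (hy₂1 : finHeckeValue L v μ y₂ = 1) :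
    finTau L v γH μ = finTau L v γH₀ μ := by
  unfold finTau
  rw [h₁, h₂, finHeckeValue_mul_eq_of_eq_one L v μ hy₁ hy₁1, finHeckeValue_mul_eq_of_eq_one L v μ hy₂ hy₂1]

/-- **THE LEVEL-`n` FORM** («`n ≥ cond μ_v`»): there is `n` such that `τ_v(γ_H) = τ_v(γ_H⁰)` whenever the two arguments at `γ_H` are those at `γ_H⁰` times box elements
`y₁, y₂` (`|(y_i)_w − 1|_w < q_w^{−(n+1)}` for all `w ∣ v`) — the reading used along a deep `H`-shell `b_H·(T_H ∩ K_H)`, where `u` and `−χ_g(u)∕det g` move in level-`n`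
cosets. [cite: Rogawski1990, §4.9 p. 55; Prop. 8.1.3 proof p. 116] [cite: TateThesis1967, §2.3] -/
theorem exists_level_forall_finTau_eq_of_mul (μ : HeckeCharacter L) :
    ∃ n : ℕ, ∀ (γH γH₀ : (UnitaryGroup.cmDatum L 2 (Matrix.of fun i j : Fin 2 => if i.val + j.val + 1 = 2 then (1 : L) else 0)).Local v ×
        (UnitaryGroup.cmDatum L 1 (Matrix.of fun i j : Fin 1 => if i.val + j.val + 1 = 1 then (1 : L) else 0)).Local v)
      (y₁ y₂ : UnitaryGroup.LocalRing L v),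
      (∀ w : PlacesOver L v, Valued.v (y₁ w - 1) < WithZero.exp (-((n + 1 : ℕ) : ℤ))) →
      (∀ w : PlacesOver L v, Valued.v (y₂ w - 1) < WithZero.exp (-((n + 1 : ℕ) : ℤ))) →
      finGammaTwo L v γH = finGammaTwo L v γH₀ * y₁ → finTauArg L v γH = finTauArg L v γH₀ * y₂ →
      finTau L v γH μ = finTau L v γH₀ μ := by
  obtain ⟨n, hn⟩ := exists_level_forall_finHeckeValue_eq_one L v μ
  refine ⟨n, fun γH γH₀ y₁ y₂ hy₁ hy₂ h₁ h₂ => ?_⟩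
  exact finTau_eq_of_mul_of_finHeckeValue_eq_one L v μ h₁ h₂ (isUnit_of_forall_valued_sub_one_lt L v hy₁) (hn y₁ hy₁)
    (isUnit_of_forall_valued_sub_one_lt L v hy₂) (hn y₂ hy₂)

/-! ## §3 The neighbourhood form of the local constancy of `τ_v` -/

/-- **`τ_v` IS CONSTANT ON A NEIGHBOURHOOD of every `γ_H⁰` with `χ_g(u)` a unit** — ★ `finTau_eventually_eq` read as `∃ U ∈ 𝓝 γ_H⁰, ∀ γ_H ∈ U, τ_v(γ_H) = τ_v(γ_H⁰)`.
[cite: Rogawski1990, §4.9 p. 55; Prop. 8.1.3 proof p. 116] -/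
theorem exists_nhds_forall_finTau_eq (μ : HeckeCharacter L)
    {γH₀ : (UnitaryGroup.cmDatum L 2 (Matrix.of fun i j : Fin 2 => if i.val + j.val + 1 = 2 then (1 : L) else 0)).Local v ×
      (UnitaryGroup.cmDatum L 1 (Matrix.of fun i j : Fin 1 => if i.val + j.val + 1 = 1 then (1 : L) else 0)).Local v}
    (hu₀ : IsUnit ((finCharpolyTwo L v γH₀).eval (finGammaTwo L v γH₀))) :
    ∃ U ∈ 𝓝 γH₀, ∀ γH ∈ U, finTau L v γH μ = finTau L v γH₀ μ :=
  (finTau_eventually_eq L v μ hu₀).exists_mem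

/-! ## §4 (ED. 2) The arguments of `τ_v` at the diagonal Levi frame of `hlevi` -/

/-- **`χ_g(u) = (u − d'₀)(u − d'₁)`** when the `U(Φ₂)`-part of `γ_H` is the diagonal `glDiagonal 2 d'` (the `hlevi` frame). [cite: Rogawski1990, §4.9 p. 55] -/
theorem finCharpolyTwo_eval_eq_of_glDiagonal_eq
    {γH : (UnitaryGroup.cmDatum L 2 (Matrix.of fun i j : Fin 2 => if i.val + j.val + 1 = 2 then (1 : L) else 0)).Local v ×
      (UnitaryGroup.cmDatum L 1 (Matrix.of fun i j : Fin 1 => if i.val + j.val + 1 = 1 then (1 : L) else 0)).Local v}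
    {d' : Fin 2 → (UnitaryGroup.LocalRing L v)ˣ} (hd' : glDiagonal 2 (UnitaryGroup.LocalRing L v) d' = γH.1.val) (x : UnitaryGroup.LocalRing L v) :
    (finCharpolyTwo L v γH).eval x = (x - d' 0) * (x - d' 1) := by
  unfold finCharpolyTwo
  have hval : (γH.1.val.val : Matrix (Fin 2) (Fin 2) (UnitaryGroup.LocalRing L v)) =
      Matrix.diagonal fun k => (d' k : UnitaryGroup.LocalRing L v) := by
    rw [← hd']; exact coe_glDiagonal 2 (UnitaryGroup.LocalRing L v) d'
  rw [hval, Matrix.charpoly_diagonal, Polynomial.eval_prod, Fin.prod_univ_two]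
  simp only [Polynomial.eval_sub, Polynomial.eval_X, Polynomial.eval_C]

/-- **`−χ_g(u)∕det g = −(u − d'₀)(u − d'₁)·(d'₀⁻¹·d'₁⁻¹)`** at the diagonal Levi frame `glDiagonal 2 d' = γ_H.1` (`u = finGammaTwo γ_H`; ★ `finTauArg` unfolded with Mathlib
`Matrix.charpoly_diagonal`, `Matrix.det_diagonal`) — the second argument of `τ_v` in the `hlevi` currency, ready for the coset bookkeeping of §2.
[cite: Rogawski1990, §4.9 p. 55] -/
theorem finTauArg_eq_of_glDiagonal_eq
    {γH : (UnitaryGroup.cmDatum L 2 (Matrix.of fun i j : Fin 2 => if i.val + j.val + 1 = 2 then (1 : L) else 0)).Local v ×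
      (UnitaryGroup.cmDatum L 1 (Matrix.of fun i j : Fin 1 => if i.val + j.val + 1 = 1 then (1 : L) else 0)).Local v}
    {d' : Fin 2 → (UnitaryGroup.LocalRing L v)ˣ} (hd' : glDiagonal 2 (UnitaryGroup.LocalRing L v) d' = γH.1.val) :
    finTauArg L v γH = -((finGammaTwo L v γH - d' 0) * (finGammaTwo L v γH - d' 1)) *
      ((((d' 0)⁻¹ : (UnitaryGroup.LocalRing L v)ˣ) : UnitaryGroup.LocalRing L v) * (((d' 1)⁻¹ : (UnitaryGroup.LocalRing L v)ˣ) : UnitaryGroup.LocalRing L v)) := by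
  unfold finTauArg
  have hinv : ((γH.1.val⁻¹).val : Matrix (Fin 2) (Fin 2) (UnitaryGroup.LocalRing L v)) =
      Matrix.diagonal fun k => (((d' k)⁻¹ : (UnitaryGroup.LocalRing L v)ˣ) : UnitaryGroup.LocalRing L v) := by
    rw [← hd', ← map_inv]; exact coe_glDiagonal 2 (UnitaryGroup.LocalRing L v) d'⁻¹
  rw [finCharpolyTwo_eval_eq_of_glDiagonal_eq L v hd', hinv, Matrix.det_diagonal, Fin.prod_univ_two]

end Summit.HodgeConjecture.HodgeConjecture.Cruxes.H413.F0P3cStCharTSMuTrivial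

end
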